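import Summits.QuantumFields.YangMills.Theorems.UnitScaleTiltProp7CorrectedParamLevelBound
import Summits.QuantumFields.YangMills.Theorems.UnitScaleTiltProp7CorrectedParamTowerMass
import Summits.QuantumFields.YangMills.Theorems.UnitScaleTiltProp7TowerClosenessGeometric
import Summits.QuantumFields.YangMills.Theorems.UnitScaleTiltProp8ChartTransport
import HarnessLib

/-!
# (q-gauge) «FR₂-lite» ROAD (route R2) — **THE PER-LEVEL LETTER AT A MEMBER: on the frame-chart ball `‖A(b)‖ ≤ e·η` of a printed-regular background, the one-level frame-corrected
# parameter built on ANY level-`j` site function `Λ` obeys `‖Λ′(y)‖ ≤ (1 + 48δ_j)·|Idx|⁻¹Σ_i ‖Λ(x_i(y))‖ + 600·δ_j·Σ_{x∈B(y)} ‖Λ x‖`, `δ_j = 60L(2e + 2700Lε₀)·(Lʲη)` GEOMETRIC in `j`**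

Cell `ym3-torus` (HUMAN RULING D-0037, YM ladder rung R3 — SU(2) YM₃ on T³: NOT d = 4, NOT infinite volume, NOT a mass gap, NOT Clay).  Width seat `ym3-torus-px16` (gen 15);
THEOREMS ONLY (0 `def`, 0 `sorry`, default heartbeats); `--supports stmt-QuantumFields-19200 --as helper`; count-neutral; NO claim on crux ∕ stub ∕ registry.

WHY.  Route R2 of the «FR₂-lite» LOCATE (19200 evidence #53∕#57): F-A (✓∕⧗`Prop7CorrectedParamLevelBound.norm_correctedParam_level_le_sum`) bounds the one-level corrected parameter
`w⁻¹·(Λ(ŷ) − E·w⁻¹)·w`, `E = D eml(τ)((Λ(ŷ) − a)·τ)`, `a_i = P_i·Λ(x_i)·P_i⁻¹`, by `‖w⁻¹‖‖w‖·|Idx|⁻¹Σ‖a_i‖ + ‖w⁻¹‖·163·‖Λ(ŷ) − a‖·‖τ − 1‖`; F-B (✓∕⧗`Prop7CorrectedParamTowerMass`) sums such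
letters over blocks and levels.  THIS FILE instantiates the letter at a MEMBER `(F, n, K)`, level `j < K − n`, background `U₀ ∈ 𝔘(ε₀)` (`RegPr`), chart point `A` with `‖A(b)‖ ≤ e·η`: the
stair family `τ` of the ACTUAL double-bar field `D̄_j = dbarCovIterU j U₀♭ (e^{A}U₀♭)` against `Ū₀ʲ` is within `δ_j := 60L(2e + 2700Lε₀)·(Lʲη)` of `1` (✓`norm_tstairU_sub_one_le_geom_of_regPr`
— GEOMETRIC in the level), `Ū₀ʲ` is `U1`-valued (✓`emlIterU_bgUnits_mem_U1_of_regPr`), so `‖P_i^{±1}‖ ≤ 1 + 2δ_j` (`P_i = τ_i·Ū₀ʲ(Γ_i)`), `‖w − 1‖ ≤ 12δ_j` (✓`norm_eml_add_sub_eml_le`),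
`‖w⁻¹ − 1‖ ≤ 24δ_j` (✓`norm_inv_sub_one_le_two_mul`), and the centre∕stair values sit below the block sum (F-B §1) ⇒ **`‖Λ′(y)‖ ≤ (1 + 48δ_j)·|Idx|⁻¹Σ_i‖Λ(x_i(y))‖ + 600δ_j·Σ_{x∈B(y)}‖Λ x‖`**
for `δ_j ≤ 1∕48` — F-B §2's pointwise letter with `α_j = 1 + 48δ_j`, `β_j = 600δ_j`, hence the level factor `θ_j = 1 + 48δ_j + 600L³δ_j ≤ 1 + 650·L³·δ_j` whose product over `j < K − n` is
`≤ exp(650·60·L⁴(2e + 2700Lε₀)·L∕(L−1))` — L-ONLY (K-free).  `Λ` is ARBITRARY here; the sequel instantiates it with the frame-corrected parameter of the spike via w5 g6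
✓`Prop7SymFrameGaugeResponseAt.hasDerivAt_frameAccU_succ_at` + F-A §1 and hands `M z` to px12 g18's Cauchy door (F-C).

WHAT IS PROVED (namespace `…Theorems.Prop7CorrectedParamMemberStep`; member `F`, `n ≤ K` implicit in `RegPr`).
* §1 `norm_units_le_of_sub_one`, `norm_units_inv_le_of_sub_one` (unit norms from `‖u − 1‖ ≤ s ≤ 1∕2`), `norm_conj_le_mul` (`‖P·m·P⁻¹‖ ≤ ‖P‖‖P⁻¹‖‖m‖`).
* §2 ★ `norm_tstair_family_sub_one_le` — the Pi-norm form of ✓`norm_tstairU_sub_one_le_geom_of_regPr`: `‖τ − 1‖ ≤ δ_j`.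
* §3 ★★★ `norm_correctedStep_member_le` — the displayed per-level letter (any `Λ`), `δ_j ≤ 1∕48`.
HONEST SCOPE.  One estimate over landed letters; the identification of `Λ′` with the next corrected parameter, the k-level assembly, Cauchy and «FR₂-lite» are NOT here; `hqG`, norm_H₁, norm_G, EX,
the crux and rung R3 are NOT proved; the Yang–Mills mass gap is NOT proved.

References: T. Bałaban, CMP **98** (1985) 17–51 [Balaban1985Averaging] ((11) p.19, (82) p.30, (97) p.32, (161)–(163) p.42); CMP **99** (1985) 389–434 [Balaban1985BackgroundPropagators]
((3.19) p.393, (3.114)–(3.115) p.418); CMP **102** (1985) 277–309 [Balaban1985Variational] ((2) p.278); CMP **109** (1987) 249–301 [Balaban1987RG1] ((0.3)–(0.8) pp.252–253).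
-/

set_option autoImplicit false

noncomputable section

open scoped BigOperators Matrix.Norms.L2Operator

namespace Summit.QuantumFields.YangMills.Theorems.Prop7CorrectedParamMemberStep

open Finset NormedSpace
open Literature.MathematicalPhysics.QuantumFieldTheory.Balaban1983to89
open Literature.MathematicalPhysics.QuantumFieldTheory.Balaban1983to89.T3ContinuumYM3Torus
open T4Continuum BlockAveraging ExpMeanLog
open B10Eq27TorusAxialLog (holT transl)
open B7Prop1Explicit (expUnit disp U1 mem_U1)
open B7TransferAnalyticMean (meanCLM)
open T3PrintedRegularMinimiser (RegPr)
open T3SectALandauChart (bgUnits eta eta_pos)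
open BlockAveragingEMLAnalyticMean (norm_eml_add_sub_eml_le eml_one)
open Summit.QuantumFields.YangMills.Theorems.Prop8Chart (emlIterU norm_inv_sub_one_le_two_mul)
open Summit.QuantumFields.YangMills.Theorems.Prop7SymAvgTwSym (tstairU tstairU_def vframeCovU coe_vframeCovU dbarCovIterU norm_tstairU_sub_one_le_geom_of_regPr
  emlIterU_bgUnits_mem_U1_of_regPr holT_mem_U1)
open Summit.QuantumFields.YangMills.Theorems.Prop7CorrectedParamLevelBound (norm_correctedParam_level_le_sum)
open Summit.QuantumFields.YangMills.Theorems.Prop7CorrectedParamTowerMass (norm_apply_emb_le_sum_block norm_apply_stair_le_sum_block norm_sub_family_le)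

/-! ## §1 Unit-norm letters -/

section Units

variable {𝔸 : Type*} [NormedRing 𝔸] [NormOneClass 𝔸]

/-- `‖u‖ ≤ 1 + s` from `‖u − 1‖ ≤ s`. [folklore] -/
theorem norm_units_le_of_sub_one {u : 𝔸ˣ} {s : ℝ} (hu : ‖(u : 𝔸) - 1‖ ≤ s) : ‖(u : 𝔸)‖ ≤ 1 + s := by
  calc ‖(u : 𝔸)‖ = ‖((u : 𝔸) - 1) + 1‖ := by rw [sub_add_cancel]
    _ ≤ ‖(u : 𝔸) - 1‖ + ‖(1 : 𝔸)‖ := norm_add_le _ _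
    _ ≤ s + 1 := by rw [norm_one]; gcongr
    _ = 1 + s := add_comm _ _

/-- `‖u⁻¹‖ ≤ 1 + 2s` from `‖u − 1‖ ≤ s ≤ 1∕2` (✓`norm_inv_sub_one_le_two_mul`). [folklore] -/
theorem norm_units_inv_le_of_sub_one [CompleteSpace 𝔸] {u : 𝔸ˣ} {s : ℝ} (hu : ‖(u : 𝔸) - 1‖ ≤ s) (hs : s ≤ 1 / 2) : ‖((u⁻¹ : 𝔸ˣ) : 𝔸)‖ ≤ 1 + 2 * s := by
  have h := norm_inv_sub_one_le_two_mul hu hs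
  calc ‖((u⁻¹ : 𝔸ˣ) : 𝔸)‖ = ‖(((u⁻¹ : 𝔸ˣ) : 𝔸) - 1) + 1‖ := by rw [sub_add_cancel]
    _ ≤ ‖((u⁻¹ : 𝔸ˣ) : 𝔸) - 1‖ + ‖(1 : 𝔸)‖ := norm_add_le _ _
    _ ≤ 2 * s + 1 := by rw [norm_one]; gcongr
    _ = 1 + 2 * s := add_comm _ _

omit [NormOneClass 𝔸] in
/-- `‖P·m·Q‖ ≤ ‖P‖·‖Q‖·‖m‖`. [folklore] -/
theorem norm_conj_le_mul (P Q m : 𝔸) : ‖P * m * Q‖ ≤ ‖P‖ * ‖Q‖ * ‖m‖ := by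
  calc ‖P * m * Q‖ ≤ ‖P * m‖ * ‖Q‖ := norm_mul_le _ _
    _ ≤ ‖P‖ * ‖m‖ * ‖Q‖ := by gcongr; exact norm_mul_le _ _
    _ = ‖P‖ * ‖Q‖ * ‖m‖ := by ring

end Units

/-! ## §2 The stair family of the actual double-bar field is within `δ_j` of `1` (Pi-norm form of the geometric closeness) -/

section Member

variable (F : T3Family) {n K : ℕ}

set_option maxHeartbeats 400000 in
-- HEARTBEAT rule (README): the member-level `tstairU`∕`dbarCovIterU` terms make `whnf` heavy (px8 g17 measured > 100k); decl-local budget, line-neutral.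
/-- ★ **`‖τ_j(y) − 1‖ ≤ δ_j := 60L(2e + 2700Lε₀)·(Lʲη)`** in the sup norm over `Idx` — ✓`norm_tstairU_sub_one_le_geom_of_regPr` index by index. [cite: Balaban1985Averaging, (161)–(163) p.42; Balaban1985Variational, (2) p.278] -/
theorem norm_tstair_family_sub_one_le {ε₀ e : ℝ} (hε₀ : 0 < ε₀) (he : 0 ≤ e) (hWe : 10 ^ 9 * (F.L : ℝ) ^ 2 * e ≤ 1) (hWε : 10 ^ 12 * (F.L : ℝ) ^ 3 * ε₀ ≤ 1)
    (U₀ : GaugeField (F.P K) 0 (Matrix.specialUnitaryGroup (Fin 2) ℂ)) (hreg : RegPr F n K ε₀ U₀)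
    (A : PBond (F.P K) 0 → Matrix (Fin 2) (Fin 2) ℂ) (hA : ∀ b, ‖A b‖ ≤ e * eta F n K) {j : ℕ} (hj : j < K - n) (y : Site (F.P K) (j + 1)) :
    ‖(fun i : Idx (F.P K) => ((tstairU (emlIterU j (bgUnits F K U₀)) (dbarCovIterU j (bgUnits F K U₀) (fun b => expUnit (A b) * bgUnits F K U₀ b)) y i :
        (Matrix (Fin 2) (Fin 2) ℂ)ˣ) : Matrix (Fin 2) (Fin 2) ℂ)) - 1‖ ≤ 60 * (F.L : ℝ) * ((2 * e + 2700 * (F.L : ℝ) * ε₀) * ((F.L : ℝ) ^ j * eta F n K)) := by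
  refine (pi_norm_le_iff_of_nonneg (by have := eta_pos F n K; positivity)).2 fun i => ?_
  rw [Pi.sub_apply, Pi.one_apply]
  exact norm_tstairU_sub_one_le_geom_of_regPr F hε₀ he hWe hWε U₀ hreg A hA hj y i

/-! ## §3 The per-level letter -/

set_option maxHeartbeats 400000 in
-- HEARTBEAT rule (README): measured cost ∈ (150k, 180k] at the farm (px8 g17 probe); decl-local budget, line-neutral.
/-- ★★★ **THE PER-LEVEL LETTER OF ROUTE R2 AT A MEMBER**: for `U₀ ∈ 𝔘(ε₀)`, `‖A(b)‖ ≤ e·η` (windows `10⁹L²e ≤ 1`, `10¹²L³ε₀ ≤ 1`), `j < K − n`, `δ := 60L(2e + 2700Lε₀)·(Lʲη) ≤ 1∕48`, and ANY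
level-`j` site function `Λ`: with `D̄ = dbarCovIterU j U₀♭ (e^{A}U₀♭)`, `Ū = Ū₀ʲ`, `τ_i = tstairU Ū D̄ y i`, `w = w_sym(Ū; D̄)(y)`, `P_i = D̄(Γ_{y,i})`, `a_i = P_i·Λ(x_i)·P_i⁻¹`,
`E = D eml(τ)((Λ(ŷ) − a)·τ)`:  `‖w⁻¹·(Λ(ŷ) − E·w⁻¹)·w‖ ≤ (1 + 48δ)·|Idx|⁻¹Σ_i ‖Λ(x_i(y))‖ + 600·δ·Σ_{x∈B(y)} ‖Λ x‖`.
[cite: Balaban1985Averaging, (82) p.30, (97) p.32, (161)–(163) p.42; Balaban1985BackgroundPropagators, (3.19) p.393, (3.114)–(3.115) p.418; Balaban1987RG1, (0.8) p.253] -/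
theorem norm_correctedStep_member_le {ε₀ e : ℝ} (hε₀ : 0 < ε₀) (he : 0 ≤ e) (hWe : 10 ^ 9 * (F.L : ℝ) ^ 2 * e ≤ 1) (hWε : 10 ^ 12 * (F.L : ℝ) ^ 3 * ε₀ ≤ 1)
    (U₀ : GaugeField (F.P K) 0 (Matrix.specialUnitaryGroup (Fin 2) ℂ)) (hreg : RegPr F n K ε₀ U₀)
    (A : PBond (F.P K) 0 → Matrix (Fin 2) (Fin 2) ℂ) (hA : ∀ b, ‖A b‖ ≤ e * eta F n K) {j : ℕ} (hj : j < K - n)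
    (hδ : 60 * (F.L : ℝ) * ((2 * e + 2700 * (F.L : ℝ) * ε₀) * ((F.L : ℝ) ^ j * eta F n K)) ≤ 1 / 48)
    (y : Site (F.P K) (j + 1)) (Λ : Site (F.P K) j → Matrix (Fin 2) (Fin 2) ℂ) :
    ‖(((vframeCovU (emlIterU j (bgUnits F K U₀)) (dbarCovIterU j (bgUnits F K U₀) (fun b => expUnit (A b) * bgUnits F K U₀ b)) y)⁻¹ : (Matrix (Fin 2) (Fin 2) ℂ)ˣ) : Matrix (Fin 2) (Fin 2) ℂ)
        * (Λ (emb y) - fderiv ℂ (eml : (Idx (F.P K) → Matrix (Fin 2) (Fin 2) ℂ) → Matrix (Fin 2) (Fin 2) ℂ)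
              (fun i : Idx (F.P K) => ((tstairU (emlIterU j (bgUnits F K U₀)) (dbarCovIterU j (bgUnits F K U₀) (fun b => expUnit (A b) * bgUnits F K U₀ b)) y i :
                (Matrix (Fin 2) (Fin 2) ℂ)ˣ) : Matrix (Fin 2) (Fin 2) ℂ))
              ((fun i : Idx (F.P K) => Λ (emb y)
                  - ((holT (dbarCovIterU j (bgUnits F K U₀) (fun b => expUnit (A b) * bgUnits F K U₀ b)) (emb y) (stairWord i.2.1 (off i.1)) : (Matrix (Fin 2) (Fin 2) ℂ)ˣ) : Matrix (Fin 2) (Fin 2) ℂ)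
                    * Λ (transl (emb y) (disp (stairWord i.2.1 (off i.1))))
                    * (((holT (dbarCovIterU j (bgUnits F K U₀) (fun b => expUnit (A b) * bgUnits F K U₀ b)) (emb y) (stairWord i.2.1 (off i.1)))⁻¹ : (Matrix (Fin 2) (Fin 2) ℂ)ˣ) :
                      Matrix (Fin 2) (Fin 2) ℂ))
                * fun i : Idx (F.P K) => ((tstairU (emlIterU j (bgUnits F K U₀)) (dbarCovIterU j (bgUnits F K U₀) (fun b => expUnit (A b) * bgUnits F K U₀ b)) y i :
                    (Matrix (Fin 2) (Fin 2) ℂ)ˣ) : Matrix (Fin 2) (Fin 2) ℂ))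
            * (((vframeCovU (emlIterU j (bgUnits F K U₀)) (dbarCovIterU j (bgUnits F K U₀) (fun b => expUnit (A b) * bgUnits F K U₀ b)) y)⁻¹ : (Matrix (Fin 2) (Fin 2) ℂ)ˣ) :
              Matrix (Fin 2) (Fin 2) ℂ))
        * ((vframeCovU (emlIterU j (bgUnits F K U₀)) (dbarCovIterU j (bgUnits F K U₀) (fun b => expUnit (A b) * bgUnits F K U₀ b)) y : (Matrix (Fin 2) (Fin 2) ℂ)ˣ) : Matrix (Fin 2) (Fin 2) ℂ)‖
      ≤ (1 + 48 * (60 * (F.L : ℝ) * ((2 * e + 2700 * (F.L : ℝ) * ε₀) * ((F.L : ℝ) ^ j * eta F n K))))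
            * ((Fintype.card (Idx (F.P K)) : ℝ)⁻¹ * ∑ i : Idx (F.P K), ‖Λ (transl (emb y) (disp (stairWord i.2.1 (off i.1))))‖)
        + 600 * (60 * (F.L : ℝ) * ((2 * e + 2700 * (F.L : ℝ) * ε₀) * ((F.L : ℝ) ^ j * eta F n K))) * ∑ x ∈ block y, ‖Λ x‖ := by
  -- letters
  set δ : ℝ := 60 * (F.L : ℝ) * ((2 * e + 2700 * (F.L : ℝ) * ε₀) * ((F.L : ℝ) ^ j * eta F n K)) with hδdef
  set Dbar := dbarCovIterU j (bgUnits F K U₀) (fun b => expUnit (A b) * bgUnits F K U₀ b) with hDbar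
  set Ubar := emlIterU j (bgUnits F K U₀) with hUbar
  set τ : Idx (F.P K) → Matrix (Fin 2) (Fin 2) ℂ := fun i => ((tstairU Ubar Dbar y i : (Matrix (Fin 2) (Fin 2) ℂ)ˣ) : Matrix (Fin 2) (Fin 2) ℂ) with hτ
  set w : (Matrix (Fin 2) (Fin 2) ℂ)ˣ := vframeCovU Ubar Dbar y with hw
  set a : Idx (F.P K) → Matrix (Fin 2) (Fin 2) ℂ := fun i => ((holT Dbar (emb y) (stairWord i.2.1 (off i.1)) : (Matrix (Fin 2) (Fin 2) ℂ)ˣ) : Matrix (Fin 2) (Fin 2) ℂ)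
    * Λ (transl (emb y) (disp (stairWord i.2.1 (off i.1)))) * (((holT Dbar (emb y) (stairWord i.2.1 (off i.1)))⁻¹ : (Matrix (Fin 2) (Fin 2) ℂ)ˣ) : Matrix (Fin 2) (Fin 2) ℂ) with ha
  have hjK : j ≤ K - n := hj.le
  have hjmK : j + 1 ≤ (F.P K).m + (F.P K).K := by show j + 1 ≤ F.m + K; omega
  have hδ0 : 0 ≤ δ := by have := eta_pos F n K; positivity
  have hδ2 : δ ≤ 1 / 2 := hδ.trans (by norm_num)
  -- closeness of the stair family
  have hτ1 : ‖τ - 1‖ ≤ δ := norm_tstair_family_sub_one_le F hε₀ he hWe hWε U₀ hreg A hA hj y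
  have hτ24 : ‖τ - 1‖ ≤ 1 / 24 := hτ1.trans (hδ.trans (by norm_num))
  have hτi : ∀ i : Idx (F.P K), ‖τ i - 1‖ ≤ δ := fun i => by
    have := norm_le_pi_norm (τ - 1) i
    rw [Pi.sub_apply, Pi.one_apply] at this
    exact this.trans hτ1
  -- the background tower is `U1`-valued
  have hε7 : 10 ^ 7 * (F.L : ℝ) ^ 3 * ε₀ ≤ 1 := by
    have : 0 ≤ (F.L : ℝ) ^ 3 * ε₀ := by positivity
    nlinarith
  have hU1 : ∀ i : Idx (F.P K), ‖((holT Ubar (emb y) (stairWord i.2.1 (off i.1)) : (Matrix (Fin 2) (Fin 2) ℂ)ˣ) : Matrix (Fin 2) (Fin 2) ℂ)‖ ≤ 1 ∧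
      ‖(((holT Ubar (emb y) (stairWord i.2.1 (off i.1)))⁻¹ : (Matrix (Fin 2) (Fin 2) ℂ)ˣ) : Matrix (Fin 2) (Fin 2) ℂ)‖ ≤ 1 :=
    fun i => mem_U1.1 (holT_mem_U1 (fun b => emlIterU_bgUnits_mem_U1_of_regPr F hε₀ hε7 hreg hjK b) _ _)
  -- `P_i = τ_i · Ū(Γ_i)` and its norms
  have hP : ∀ i : Idx (F.P K), holT Dbar (emb y) (stairWord i.2.1 (off i.1)) = tstairU Ubar Dbar y i * holT Ubar (emb y) (stairWord i.2.1 (off i.1)) := fun i => by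
    rw [tstairU_def, inv_mul_cancel_right]
  have hPn : ∀ i : Idx (F.P K), ‖((holT Dbar (emb y) (stairWord i.2.1 (off i.1)) : (Matrix (Fin 2) (Fin 2) ℂ)ˣ) : Matrix (Fin 2) (Fin 2) ℂ)‖ ≤ 1 + δ := fun i => by
    rw [hP i, Units.val_mul]
    calc _ ≤ ‖τ i‖ * ‖((holT Ubar (emb y) (stairWord i.2.1 (off i.1)) : (Matrix (Fin 2) (Fin 2) ℂ)ˣ) : Matrix (Fin 2) (Fin 2) ℂ)‖ := norm_mul_le _ _
      _ ≤ (1 + δ) * 1 := by gcongr; exacts [norm_units_le_of_sub_one (hτi i), (hU1 i).1]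
      _ = 1 + δ := mul_one _
  have hPin : ∀ i : Idx (F.P K), ‖(((holT Dbar (emb y) (stairWord i.2.1 (off i.1)))⁻¹ : (Matrix (Fin 2) (Fin 2) ℂ)ˣ) : Matrix (Fin 2) (Fin 2) ℂ)‖ ≤ 1 + 2 * δ := fun i => by
    rw [hP i, mul_inv_rev, Units.val_mul]
    calc _ ≤ ‖(((holT Ubar (emb y) (stairWord i.2.1 (off i.1)))⁻¹ : (Matrix (Fin 2) (Fin 2) ℂ)ˣ) : Matrix (Fin 2) (Fin 2) ℂ)‖ * ‖(((tstairU Ubar Dbar y i)⁻¹ : (Matrix (Fin 2) (Fin 2) ℂ)ˣ) : Matrix (Fin 2) (Fin 2) ℂ)‖ := norm_mul_le _ _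
      _ ≤ 1 * (1 + 2 * δ) := by gcongr; exacts [(hU1 i).2, norm_units_inv_le_of_sub_one (hτi i) hδ2]
      _ = 1 + 2 * δ := one_mul _
  -- `‖a_i‖ ≤ (1+δ)(1+2δ)·‖Λ(x_i)‖`
  have han : ∀ i : Idx (F.P K), ‖a i‖ ≤ (1 + δ) * (1 + 2 * δ) * ‖Λ (transl (emb y) (disp (stairWord i.2.1 (off i.1))))‖ := fun i => by
    rw [ha]
    exact (norm_conj_le_mul _ _ _).trans (by gcongr; exacts [hPn i, hPin i])
  -- the frame: `‖w − 1‖ ≤ 12δ`, hence `‖w‖ ≤ 1 + 12δ`, `‖w⁻¹‖ ≤ 1 + 24δ`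
  have hweml : ((w : (Matrix (Fin 2) (Fin 2) ℂ)ˣ) : Matrix (Fin 2) (Fin 2) ℂ) = eml τ := by rw [hw, coe_vframeCovU]
  have hw1 : ‖(w : Matrix (Fin 2) (Fin 2) ℂ) - 1‖ ≤ 12 * δ := by
    have h := norm_eml_add_sub_eml_le (ι := Idx (F.P K)) (𝔸 := Matrix (Fin 2) (Fin 2) ℂ) (U := 1) (V := τ - 1) (by rw [sub_self, norm_zero]; norm_num) hτ24
    rw [add_sub_cancel, eml_one] at h
    rw [hweml]
    exact h.trans (by linarith)
  have hwn : ‖(w : Matrix (Fin 2) (Fin 2) ℂ)‖ ≤ 1 + 12 * δ := norm_units_le_of_sub_one hw1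
  have hwin : ‖((w⁻¹ : (Matrix (Fin 2) (Fin 2) ℂ)ˣ) : Matrix (Fin 2) (Fin 2) ℂ)‖ ≤ 1 + 2 * (12 * δ) := norm_units_inv_le_of_sub_one hw1 (by linarith)
  -- the block letters: centre and stair values below the block sum
  have hΛ0 : ‖Λ (emb y)‖ ≤ ∑ x ∈ block y, ‖Λ x‖ := norm_apply_emb_le_sum_block hjmK Λ y
  have hΛi : ∀ i : Idx (F.P K), ‖Λ (transl (emb y) (disp (stairWord i.2.1 (off i.1))))‖ ≤ ∑ x ∈ block y, ‖Λ x‖ := fun i => norm_apply_stair_le_sum_block hjmK Λ y i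
  have hS0 : 0 ≤ ∑ x ∈ block y, ‖Λ x‖ := sum_nonneg fun _ _ => norm_nonneg _
  have hp0 : 0 ≤ (1 + δ) * (1 + 2 * δ) := by positivity
  have hai : ∀ i : Idx (F.P K), ‖a i‖ ≤ (1 + δ) * (1 + 2 * δ) * ∑ x ∈ block y, ‖Λ x‖ := fun i =>
    (han i).trans (mul_le_mul_of_nonneg_left (hΛi i) hp0)
  have hσ : ‖(fun i : Idx (F.P K) => Λ (emb y) - a i)‖ ≤ ∑ x ∈ block y, ‖Λ x‖ + (1 + δ) * (1 + 2 * δ) * ∑ x ∈ block y, ‖Λ x‖ :=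
    (norm_sub_family_le (Λ (emb y)) a (mul_nonneg hp0 hS0) hai).trans (add_le_add hΛ0 le_rfl)
  -- F-A's letter at this level
  have hFA := norm_correctedParam_level_le_sum (P := F.P K) hτ24 w hweml (Λ (emb y)) a
  -- the index mean of `‖a_i‖`
  set M : ℝ := (Fintype.card (Idx (F.P K)) : ℝ)⁻¹ * ∑ i : Idx (F.P K), ‖Λ (transl (emb y) (disp (stairWord i.2.1 (off i.1))))‖ with hMdef
  set S : ℝ := ∑ x ∈ block y, ‖Λ x‖ with hSdef
  have hM0 : 0 ≤ M := by positivity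
  have hsum : ∑ i : Idx (F.P K), ‖a i‖ ≤ (1 + δ) * (1 + 2 * δ) * ∑ i : Idx (F.P K), ‖Λ (transl (emb y) (disp (stairWord i.2.1 (off i.1))))‖ := by
    rw [mul_sum]; exact sum_le_sum fun i _ => han i
  have hmean : (Fintype.card (Idx (F.P K)) : ℝ)⁻¹ * ∑ i : Idx (F.P K), ‖a i‖ ≤ (1 + δ) * (1 + 2 * δ) * M :=
    (mul_le_mul_of_nonneg_left hsum (inv_nonneg.2 (Nat.cast_nonneg _))).trans_eq (by rw [hMdef]; ring)
  -- the two scalar coefficient inequalities on `[0, 1∕48]`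
  have h48 : δ ≤ 1 / 48 := hδ
  have hd2 : δ * δ ≤ δ * (1 / 48) := mul_le_mul_of_nonneg_left h48 hδ0
  have hd3 : δ * δ * δ ≤ δ * (1 / 48) * (1 / 48) := mul_le_mul hd2 h48 hδ0 (by positivity)
  have hd4 : δ * δ * δ * δ ≤ δ * (1 / 48) * (1 / 48) * (1 / 48) := mul_le_mul hd3 h48 hδ0 (by positivity)
  have hcoefM : (1 + 2 * (12 * δ)) * (1 + 12 * δ) * ((1 + δ) * (1 + 2 * δ)) ≤ 1 + 48 * δ := by
    have e : (1 + 2 * (12 * δ)) * (1 + 12 * δ) * ((1 + δ) * (1 + 2 * δ)) = 1 + 39 * δ + 398 * (δ * δ) + 936 * (δ * δ * δ) + 576 * (δ * δ * δ * δ) := by ring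
    rw [e]; linarith
  have hcoefS : (1 + 2 * (12 * δ)) * (163 * (1 + (1 + δ) * (1 + 2 * δ))) ≤ 600 := by
    have e : (1 + 2 * (12 * δ)) * (163 * (1 + (1 + δ) * (1 + 2 * δ))) = 326 + 8313 * δ + 12062 * (δ * δ) + 7824 * (δ * δ * δ) := by ring
    rw [e]; linarith
  -- assemble (term by term; no `gcongr` on the large terms)
  have hX0 : 0 ≤ (Fintype.card (Idx (F.P K)) : ℝ)⁻¹ * ∑ i : Idx (F.P K), ‖a i‖ :=
    mul_nonneg (inv_nonneg.2 (Nat.cast_nonneg _)) (sum_nonneg fun _ _ => norm_nonneg _)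
  have h1 : ‖((w⁻¹ : (Matrix (Fin 2) (Fin 2) ℂ)ˣ) : Matrix (Fin 2) (Fin 2) ℂ)‖ * ‖(w : Matrix (Fin 2) (Fin 2) ℂ)‖ * ((Fintype.card (Idx (F.P K)) : ℝ)⁻¹ * ∑ i : Idx (F.P K), ‖a i‖)
      ≤ (1 + 2 * (12 * δ)) * (1 + 12 * δ) * ((1 + δ) * (1 + 2 * δ) * M) :=
    mul_le_mul (mul_le_mul hwin hwn (norm_nonneg _) (by linarith)) hmean hX0 (mul_nonneg (by linarith) (by linarith))
  have h2 : ‖((w⁻¹ : (Matrix (Fin 2) (Fin 2) ℂ)ˣ) : Matrix (Fin 2) (Fin 2) ℂ)‖ * (163 * ‖(fun i : Idx (F.P K) => Λ (emb y) - a i)‖ * ‖τ - 1‖)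
      ≤ (1 + 2 * (12 * δ)) * (163 * (S + (1 + δ) * (1 + 2 * δ) * S) * δ) := by
    have hin : 163 * ‖(fun i : Idx (F.P K) => Λ (emb y) - a i)‖ * ‖τ - 1‖ ≤ 163 * (S + (1 + δ) * (1 + 2 * δ) * S) * δ :=
      mul_le_mul (mul_le_mul_of_nonneg_left hσ (by norm_num)) hτ1 (norm_nonneg _) (mul_nonneg (by norm_num) (add_nonneg hS0 (mul_nonneg hp0 hS0)))
    exact mul_le_mul hwin hin (mul_nonneg (mul_nonneg (by norm_num) (norm_nonneg _)) (norm_nonneg _)) (by linarith)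
  refine (hFA.trans (add_le_add h1 h2)).trans ?_
  calc (1 + 2 * (12 * δ)) * (1 + 12 * δ) * ((1 + δ) * (1 + 2 * δ) * M) + (1 + 2 * (12 * δ)) * (163 * (S + (1 + δ) * (1 + 2 * δ) * S) * δ)
      = (1 + 2 * (12 * δ)) * (1 + 12 * δ) * ((1 + δ) * (1 + 2 * δ)) * M + (1 + 2 * (12 * δ)) * (163 * (1 + (1 + δ) * (1 + 2 * δ))) * (δ * S) := by ring
    _ ≤ (1 + 48 * δ) * M + 600 * (δ * S) :=
        add_le_add (mul_le_mul_of_nonneg_right hcoefM hM0) (mul_le_mul_of_nonneg_right hcoefS (mul_nonneg hδ0 hS0))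
    _ = (1 + 48 * δ) * M + 600 * δ * S := by ring

end Member

end Summit.QuantumFields.YangMills.Theorems.Prop7CorrectedParamMemberStep

end
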